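import Summits.CriticalPhenomena.PercolationContinuityZ3.Theorems.PercNearOneGluingNoHeavyPcintClosingCountKernel
import HarnessLib

/-!
# CriticalPhenomena/PercolationContinuityZ3 — Theorems/PercNearOneGluingNoHeavyPcintClosingOctagonsZ3Exact.lean: `2·8·p_8(ℤ³) = 3312` EXACTLY — fixing three letters by symmetry, the rest by kernel

Lane prim-pcint, STRUCTURE rule (the third-rung density `f_8(ℤ³) = 3312/μ_6⁸`, now two-sided).  …PcintClosingCountKernel gives
`closingCount d τ = cntP (mstep τ) (HasAge (τ−1)) ∅ (τ−1)` and the first-letter reduction; the full memory-8 evaluation on `ℤ³` is out of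
the kernel's reach, and …ClosingOctagonsZ3 only certifies `≥ 3312` by witnesses.  Here the count is made EXACT by a generic branch
calculus: `brP τ j n S a` (the `a`-branch of `cntP S (n+1)`; `cntP_succ_eq_sum_brP`, `sum_letters_three`), **`brP_eq_of_symm`** (a lattice
symmetry fixing the state identifies two branches — its two hypotheses are themselves checked by `decide`), `brP_of_eq_some/none`.
Fixing the first three letters leaves 8 distinct branches of `6⁴` words each, evaluated by `decide +kernel`:
after `e₀⁺e₀⁺`: `e₀⁺ ↦ 4`, `e₀⁻ ↦ 0`, `e₁^± , e₂^± ↦ 22`; after `e₀⁺e₁⁺`: `e₀⁺ ↦ 12`, `e₀⁻ ↦ 27`, `e₁⁺ ↦ 22`, `e₁⁻ ↦ 0`, `e₂^± ↦ 27`; hence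
`92` and `115` words after `e₀⁺e₀⁺` / `e₀⁺e₁⁺` and **`closingCount_eight_zd3 : closingCount 3 8 = 3312`** (`p_8(ℤ³) = 207`).

HONEST FRAMING: kernel evaluations + bookkeeping; nothing here is used by a certified `p_c` cell.  Written by prim-pcint-2 gen 17
(prover-prim-pcint-2-g17-0), 2026-08-25.
-/

namespace Summit.CriticalPhenomena.PercolationContinuityZ3.Theorems.Pcint

open Literature.Probability.Percolation Literature.Probability.LatticeModels

variable {d : ℕ}

/-! ### Branch calculus -/

/-- The `a`-branch of `cntP (mstep τ) (HasAge j) S (n+1)`. [folklore] -/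
def brP (τ j n : ℕ) (S : MState d) (a : Fin d × Bool) : ℕ :=
  (mstep τ S a).elim 0 fun T => cntP (mstep τ) (HasAge j) T n

/-- `cntP S (n+1) = Σ_a brP S a`. [folklore] -/
theorem cntP_succ_eq_sum_brP (τ j n : ℕ) (S : MState d) :
    cntP (mstep τ) (HasAge j) S (n + 1) = ∑ a, brP τ j n S a := by
  simp only [cntP, brP]
  refine Finset.sum_congr rfl fun a _ => ?_
  cases mstep τ S a <;> rfl

/-- A branch through an allowed letter. [folklore] -/
theorem brP_of_eq_some {τ j n : ℕ} {S T : MState d} {a : Fin d × Bool} (h : mstep τ S a = some T) :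
    brP τ j n S a = cntP (mstep τ) (HasAge j) T n := by
  simp [brP, h]

/-- A branch through a refused letter is empty. [folklore] -/
theorem brP_of_eq_none {τ j n : ℕ} {S : MState d} {a : Fin d × Bool} (h : mstep τ S a = none) : brP τ j n S a = 0 := by
  simp [brP, h]

/-- **Symmetric branches are equal**: if a lattice symmetry fixes the state `S` and maps the letter `a` to `b`, the two branches
carry the same number of words. [folklore] -/
theorem brP_eq_of_symm (τ j n : ℕ) (g : SPerm d) {S : MState d} {a b : Fin d × Bool} (hS : smulState g S = S)
    (hab : smulLetter g a = b) : brP τ j n S b = brP τ j n S a := by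
  have hm : mstep τ S b = (mstep τ S a).map (smulState g) := by
    rw [← hab, ← mstep_smul, hS]
  unfold brP
  rw [hm]
  cases mstep τ S a with
  | none => rfl
  | some T => simp only [Option.map_some, Option.elim_some, cntP_hasAge_smulState]

/-- The six letters of `ℤ³`. [folklore] -/
theorem sum_letters_three (f : Fin 3 × Bool → ℕ) :
    ∑ a, f a = f (0, true) + f (0, false) + f (1, true) + f (1, false) + f (2, true) + f (2, false) := by
  rw [Fintype.sum_prod_type, Fin.sum_univ_three]
  simp only [Fintype.sum_bool]
  ring

/-! ### The octagons of `ℤ³` -/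

/-- Assembly arithmetic with abstract atoms. [folklore] -/
theorem oct3_exact_assembly {x c1 s0 s0m s1 s1m s2 s2m Xs Xp t0 t0m t1 t1m t2 t2m u0 u0m u1 u1m u2 u2m : ℕ}
    (hx : x = 2 * 3 * c1) (hc1 : c1 = s0 + s0m + s1 + s1m + s2 + s2m)
    (hs0 : s0 = Xs) (hs0m : s0m = 0) (hs1 : s1 = Xp) (hs1m : s1m = s1) (hs2 : s2 = s1) (hs2m : s2m = s1)
    (hXs : Xs = t0 + t0m + t1 + t1m + t2 + t2m) (ht0 : t0 = 4) (ht0m : t0m = 0) (ht1 : t1 = 22) (ht1m : t1m = t1)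
    (ht2 : t2 = t1) (ht2m : t2m = t1)
    (hXp : Xp = u0 + u0m + u1 + u1m + u2 + u2m) (hu0 : u0 = 12) (hu0m : u0m = 27) (hu1 : u1 = 22) (hu1m : u1m = 0)
    (hu2 : u2 = 27) (hu2m : u2m = u2) : x = 3312 := by
  subst hs1m hs2 hs2m ht1m ht2 ht2m hu2m
  omega

/-- after `e₀⁺`, the letter `e₀⁺` leads to the state `{{(−e₀,1),(−2e₀,2)}}`. [this work] -/
theorem oct3_s0 :
    brP 8 7 5 ({(-stepVec ((0 : Fin 3), true), 1)} : MState 3) (0, true) = cntP (mstep 8) (HasAge 7) ({(![-1, 0, 0], 1), (![-2, 0, 0], 2)} : MState 3) 5 :=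
  brP_of_eq_some (by decide +kernel)

/-- the reversal is refused. [this work] -/
theorem oct3_s0m :
    brP 8 7 5 ({(-stepVec ((0 : Fin 3), true), 1)} : MState 3) (0, false) = 0 :=
  brP_of_eq_none (by decide +kernel)

/-- after `e₀⁺`, the letter `e₁⁺` leads to `{{(−e₁,1),(−e₀−e₁,2)}}`. [this work] -/
theorem oct3_s1 :
    brP 8 7 5 ({(-stepVec ((0 : Fin 3), true), 1)} : MState 3) (1, true) = cntP (mstep 8) (HasAge 7) ({(![0, -1, 0], 1), (![-1, -1, 0], 2)} : MState 3) 5 :=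
  brP_of_eq_some (by decide +kernel)

/-- `e₁⁻ ~ e₁⁺` by the sign flip of axis 1. [this work] -/
theorem oct3_s1m :
    brP 8 7 5 ({(-stepVec ((0 : Fin 3), true), 1)} : MState 3) (1, false) = brP 8 7 5 ({(-stepVec ((0 : Fin 3), true), 1)} : MState 3) (1, true) :=
  brP_eq_of_symm 8 7 5 (sperm3 12) (by decide +kernel) (by decide +kernel)

/-- `e₂⁺ ~ e₁⁺` by the swap of axes 1, 2. [this work] -/
theorem oct3_s2 :
    brP 8 7 5 ({(-stepVec ((0 : Fin 3), true), 1)} : MState 3) (2, true) = brP 8 7 5 ({(-stepVec ((0 : Fin 3), true), 1)} : MState 3) (1, true) :=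
  brP_eq_of_symm 8 7 5 (sperm3 3) (by decide +kernel) (by decide +kernel)

/-- `e₂⁻ ~ e₁⁺`. [this work] -/
theorem oct3_s2m :
    brP 8 7 5 ({(-stepVec ((0 : Fin 3), true), 1)} : MState 3) (2, false) = brP 8 7 5 ({(-stepVec ((0 : Fin 3), true), 1)} : MState 3) (1, true) :=
  brP_eq_of_symm 8 7 5 (sperm3 27) (by decide +kernel) (by decide +kernel)

/-- branch `e₀⁺e₀⁺e₀⁺`: 4 closing tails (kernel, `6⁴` words). [this work] -/
theorem oct3_t0 : brP 8 7 4 ({(![-1, 0, 0], 1), (![-2, 0, 0], 2)} : MState 3) (0, true) = 4 := by decide +kernel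

/-- reversal. [this work] -/
theorem oct3_t0m :
    brP 8 7 4 ({(![-1, 0, 0], 1), (![-2, 0, 0], 2)} : MState 3) (0, false) = 0 :=
  brP_of_eq_none (by decide +kernel)

/-- branch `e₀⁺e₀⁺e₁⁺`: 22. [this work] -/
theorem oct3_t1 : brP 8 7 4 ({(![-1, 0, 0], 1), (![-2, 0, 0], 2)} : MState 3) (1, true) = 22 := by decide +kernel

/-- symmetry. [this work] -/
theorem oct3_t1m :
    brP 8 7 4 ({(![-1, 0, 0], 1), (![-2, 0, 0], 2)} : MState 3) (1, false) = brP 8 7 4 ({(![-1, 0, 0], 1), (![-2, 0, 0], 2)} : MState 3) (1, true) :=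
  brP_eq_of_symm 8 7 4 (sperm3 12) (by decide +kernel) (by decide +kernel)

/-- symmetry. [this work] -/
theorem oct3_t2 :
    brP 8 7 4 ({(![-1, 0, 0], 1), (![-2, 0, 0], 2)} : MState 3) (2, true) = brP 8 7 4 ({(![-1, 0, 0], 1), (![-2, 0, 0], 2)} : MState 3) (1, true) :=
  brP_eq_of_symm 8 7 4 (sperm3 3) (by decide +kernel) (by decide +kernel)

/-- symmetry. [this work] -/
theorem oct3_t2m :
    brP 8 7 4 ({(![-1, 0, 0], 1), (![-2, 0, 0], 2)} : MState 3) (2, false) = brP 8 7 4 ({(![-1, 0, 0], 1), (![-2, 0, 0], 2)} : MState 3) (1, true) :=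
  brP_eq_of_symm 8 7 4 (sperm3 27) (by decide +kernel) (by decide +kernel)

/-- branch `e₀⁺e₁⁺e₀⁺`: 12. [this work] -/
theorem oct3_u0 : brP 8 7 4 ({(![0, -1, 0], 1), (![-1, -1, 0], 2)} : MState 3) (0, true) = 12 := by decide +kernel

/-- branch `e₀⁺e₁⁺e₀⁻`: 27. [this work] -/
theorem oct3_u0m : brP 8 7 4 ({(![0, -1, 0], 1), (![-1, -1, 0], 2)} : MState 3) (0, false) = 27 := by decide +kernel

/-- branch `e₀⁺e₁⁺e₁⁺`: 22. [this work] -/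
theorem oct3_u1 : brP 8 7 4 ({(![0, -1, 0], 1), (![-1, -1, 0], 2)} : MState 3) (1, true) = 22 := by decide +kernel

/-- reversal. [this work] -/
theorem oct3_u1m :
    brP 8 7 4 ({(![0, -1, 0], 1), (![-1, -1, 0], 2)} : MState 3) (1, false) = 0 :=
  brP_of_eq_none (by decide +kernel)

/-- branch `e₀⁺e₁⁺e₂⁺`: 27. [this work] -/
theorem oct3_u2 : brP 8 7 4 ({(![0, -1, 0], 1), (![-1, -1, 0], 2)} : MState 3) (2, true) = 27 := by decide +kernel

/-- `e₂⁻ ~ e₂⁺` by the sign flip of axis 2. [this work] -/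
theorem oct3_u2m :
    brP 8 7 4 ({(![0, -1, 0], 1), (![-1, -1, 0], 2)} : MState 3) (2, false) = brP 8 7 4 ({(![0, -1, 0], 1), (![-1, -1, 0], 2)} : MState 3) (2, true) :=
  brP_eq_of_symm 8 7 4 (sperm3 24) (by decide +kernel) (by decide +kernel)

/-- **`2·8·p_8(ℤ³) = 3312`** (`p_8(ℤ³) = 207` octagons per site), exact kernel count assembled from the branch facts (each in its own
declaration: one `decide +kernel` per heartbeat budget; states literal, numerals canonical, so every unification is syntactic). [this work] -/
theorem closingCount_eight_zd3 : MemoryTail.closingCount 3 8 = 3312 := by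
  have e := closingCount_eq_cntP (τ := 8) (by norm_num) 3
  rw [show (8 : ℕ) - 1 = 7 from rfl] at e
  have e0 := cntP_empty_succ (d := 3) 8 7 6
  rw [show (6 : ℕ) + 1 = 7 from rfl] at e0
  have hc1 := (cntP_succ_eq_sum_brP 8 7 5 ({(-stepVec ((0 : Fin 3), true), 1)} : MState 3)).trans (sum_letters_three _)
  rw [show (5 : ℕ) + 1 = 6 from rfl] at hc1
  have hXs := (cntP_succ_eq_sum_brP 8 7 4 ({(![-1, 0, 0], 1), (![-2, 0, 0], 2)} : MState 3)).trans (sum_letters_three _)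
  rw [show (4 : ℕ) + 1 = 5 from rfl] at hXs
  have hXp := (cntP_succ_eq_sum_brP 8 7 4 ({(![0, -1, 0], 1), (![-1, -1, 0], 2)} : MState 3)).trans (sum_letters_three _)
  rw [show (4 : ℕ) + 1 = 5 from rfl] at hXp
  exact oct3_exact_assembly (e.trans e0) hc1 oct3_s0 oct3_s0m oct3_s1 oct3_s1m oct3_s2 oct3_s2m hXs oct3_t0 oct3_t0m oct3_t1
    oct3_t1m oct3_t2 oct3_t2m hXp oct3_u0 oct3_u0m oct3_u1 oct3_u1m oct3_u2 oct3_u2m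

end Summit.CriticalPhenomena.PercolationContinuityZ3.Theorems.Pcint
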